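import Literature.Probability.Percolation.TriCorrLengthExponentFromSeparation
import Literature.Probability.Percolation.ArmExponentsFourArm
import Literature.Probability.Percolation.NearCriticalFourArmQuasiMult
import HarnessLib

/-!
# `ξ(p) = |p - 1/2|^{-4/3 + o(1)}`: decomposition into Smirnov–Werner's two observations for `j = 4`

Topic `Literature/Probability/Percolation`; family `crit-perc`.  The named fact
`Literature.Probability.Percolation.triCorrLength_exponent` (`ArmExponents.lean`; crit-perc.S16,
`ν = 4/3`: S. Smirnov, W. Werner, Math. Res. Lett. 8 (2001), Thm. 1 (iii)–(iv)) is proved in the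
tree by `triCorrLength_exponent_of_scalingLimit_of_separation`
(`TriCorrLengthExponentFromSeparation.lean`) from the two observations of Smirnov–Werner's §4
read for `j = 4` arms, every discrete step of the printed proof (Kesten's scaling relation,
RSW below `L(p)`, exponential decay beyond it, `ξ ≍ L_ε`, the product-of-scales assembly, Kesten's
gluing and Nolin's colour switching) being a theorem of the tree.  Neither observation was a
declaration of the tree; this file states them as named facts, in the exact shapes the landed
reductions consume, and assembles the parent (and, from the same two inputs, the four-arm
exponent `fourArm_exponent`, crit-perc.S15):

1. `SmirnovWerner2001_fourArm_scalingLimit` — SW (16) with (9) and (15) for `j = 4`: the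
   critical alternating four-arm probabilities `π₄(ρ r, ρ R)` converge, as `ρ → ∞`, to a function
   `b'(R/r)` of the ratio with `b'(λ) = λ^{-5/4 + o(1)}` (Smirnov's theorem / Camia–Newman full
   scaling limit, and the annular `SLE₆` exponent `(4² - 1)/12` of Lawler–Schramm–Werner) — the
   four-arm twin of the existing `SmirnovWerner2001_twoArm_scalingLimit`
   (`ArmExponentsTwoArm.lean`), same shape with `1/4 ↦ 5/4`;
2. `Nolin2008_fourArm_separation` — SW (10) in P. Nolin's uniform near-critical form (Electron.
   J. Probab. 13 (2008), Thm. 11 for `j = 4`, `σ = BWBW`, after H. Kesten, Comm. Math. Phys. 109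
   (1987), Lemmas 4–6): below Werner's length `L(t, ε)` the well-separated alternating four-arm
   event `sepFourArm n N` is comparable to the four-arm event, uniformly in `t ∈ [1/2, 1/2 + δ)`
   — verbatim the hypothesis `hsep` of `Nolin2008_prop34_of_separation`,
   `Werner2009_fourArm_quasiMult_of_separation` and `triCorrLength_exponent_of_separation`.

Assemblies (one-line applications of landed theorems): `triCorrLength_exponent_holds_of`,
`fourArm_exponent_holds_of`.  Neither child restates a parent: (1) is a statement about the
*critical* four-arm probabilities at fixed ratio and their limit function, (2) a comparison of
two four-arm events; the parent is the power law of the correlation length `ξ(p)` in `p`.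

## References

* S. Smirnov, W. Werner, *Critical exponents for two-dimensional percolation*, Math. Res. Lett. 8
  (2001), 729–744 = arXiv:math/0109120: Thm. 1 (iii)–(iv), Thm. 4, §4 (9), (10), (12)–(16),
  §4.2. [SmirnovWernerMRL2001]
* P. Nolin, *Near-critical percolation in two dimensions*, Electron. J. Probab. 13 (2008),
  1562–1623: Thm. 11, Prop. 12, Prop. 17 (arXiv 0711.4948: Thm. 10, Prop. 11, Prop. 16). [Nolin2008]
* H. Kesten, *Scaling relations for 2D-percolation*, Comm. Math. Phys. 109 (1987), 109–156:
  Lemmas 4–6, (4.5), Cor. 1–2. [KestenScalingCMP1987]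
* W. Werner, *Lectures on two-dimensional critical percolation*, IAS/Park City Math. Ser. 16
  (2009), Lecture 5, Thm. 5.2; Lecture 6, §1, Cor. 6.2. [WernerPCMI2009]
-/

noncomputable section

open Filter
open scoped _root_.Topology unitInterval

namespace Literature.Probability.Percolation

open LatticeModels

/-- **Scaling limit of the critical four-arm probability and its `SLE₆` exponent `5/4`**
(Smirnov–Werner 2001, §4: (16) "It follows from [Smirnov 2001] that `b_j(ρ r, ρ R)` has a
scaling limit, which is conformally invariant, and so depends on the ratio `R/r` only:
`b'_j(R/r) = lim_ρ b_j(ρ r, ρ R)`", together with (9)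
`lim_ρ b_j^{ep}(ρ, R ρ) = R^{-(j²-1)/12 + o(1)}` when `R → ∞` — from (12), the convergence of the
exploration process to `SLE₆`, and (13)–(14), the annular `SLE₆` exponents of
Lawler–Schramm–Werner — and (15) `b_j^{ep} ≍ b_j` for even `j` (Remark 6), all specialised to
`j = 4`, where `(j² - 1)/12 = 5/4`: "In particular, `P[A_R^2] = b_4(2, R) = R^{-5/4 + o(1)}`").
In Lean: there is `b' : ℝ → ℝ` such that for all integers `1 ≤ r < R` the critical alternating
four-arm probabilities `π₄(ρ r, ρ R) = critFourArmProb (ρ r) (ρ R)` of the annuli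
`Λ_{ρR} ∖ Λ_{ρr}` converge to `b'(R/r)` as `ρ → ∞` (`ρ ∈ ℕ`), and `log b'(λ) / log λ → -5/4` as
`λ → ∞`.  Hexagonal annuli replace SW's discretised circular ones and the alternating colour
order is prescribed (SW p. 7: this changes `b_j` up to a multiplicative constant), exactly as
for the two-arm twin `SmirnovWerner2001_twoArm_scalingLimit`; this is hypothesis `hA` of
`fourArm_exponent_of_scalingLimit` (`ArmExponentsFourArm.lean`). This is the deep input
(Smirnov's theorem and the `SLE₆` four-arm exponent). [cite: SmirnovWernerMRL2001, §4 (9), (15), (16) and Thm. 4 for j = 4 (arXiv:math/0109120 numbering)] -/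
def SmirnovWerner2001_fourArm_scalingLimit : Prop :=
  ∃ b' : ℝ → ℝ,
    (∀ r R : ℕ, 1 ≤ r → r < R →
      Tendsto (fun ρ : ℕ => critFourArmProb (ρ * r) (ρ * R)) atTop (𝓝 (b' ((R : ℝ) / r)))) ∧
    Tendsto (fun l : ℝ => Real.log (b' l) / Real.log l) atTop (𝓝 (-(5 / 4)))

/-- **Near-critical four-arm separation below `L(p)`** (P. Nolin, Electron. J. Probab. 13 (2008),
Thm. 11 [arXiv 0711.4948: Thm. 10] for `j = 4` arms of colours `σ = BWBW`: the well-separated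
arm events `Ã̃^{η,I/η',I'}_{j,σ}(n, N)` with prescribed landing areas satisfy
`P̂(Ã̃_{j,σ}(n, N)) ≍ P̂(A_{j,σ}(n, N))` "uniformly in `p`, `P̂` between `P_p` and `P_{1-p}`,
and `n ≤ N ≤ L(p)`"; after H. Kesten, Comm. Math. Phys. 109 (1987), Lemmas 4–6; Smirnov–Werner
2001, §4.2 (10)).  In Lean, in the shape consumed by `Nolin2008_prop34_of_separation`,
`Werner2009_fourArm_quasiMult_of_separation` and `triCorrLength_exponent_of_separation`: for
every small `ε > 0` there are `n₀`, a right neighbourhood `[1/2, 1/2 + δ)` of `1/2` and `c > 0`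
such that `c · π̂_t(n, N) ≤ P_t(sepFourArm n N)` whenever `n₀ ≤ n`, `2n ≤ N` and, for `t > 1/2`,
`N ≤ L(t, ε)` (Werner's length `charLengthW`; no upper restriction at `t = 1/2`), where
`π̂_t(n, N) = fourArmProbAt t n N` is the alternating four-arm probability at parameter `t` and
`sepFourArm n N` (`ArmSeparationFourArm.lean`) is the tree's well-separated alternating four-arm
event with landing areas (Nolin's `η = η' = 1/64`).  Parameters `t < 1/2` are covered through
`L(t) = L(1 - t)` and colour exchange in the consumers. [cite: Nolin2008, Thm. 11 for j = 4, σ = BWBW (arXiv 0711.4948: Thm. 10)] [cite: KestenScalingCMP1987, Lemmas 4–6] -/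
def Nolin2008_fourArm_separation : Prop :=
  ∃ ε₁ > (0 : ℝ), ∀ ⦃ε : ℝ⦄, 0 < ε → ε < ε₁ →
    ∃ n₀ : ℕ, ∃ δ > (0 : ℝ), ∃ c > (0 : ℝ),
      ∀ t : unitInterval, 1 / 2 ≤ (t : ℝ) → (t : ℝ) < 1 / 2 + δ →
        ∀ n N : ℕ, n₀ ≤ n → 2 * n ≤ N → (1 / 2 < (t : ℝ) → N ≤ charLengthW ε t) →
          c * fourArmProbAt t n N ≤ (triSitePercolation t).real (sepFourArm n N)

/-- **Assembly: the four-arm exponent `5/4` (crit-perc.S15) from Smirnov–Werner's two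
observations for `j = 4`** — the scaling limit with its `SLE₆` exponent, and arm separation
(which yields the quasi-multiplicativity (10) by Kesten's gluing,
`Werner2009_fourArm_quasiMult_of_separation`) — by `fourArm_exponent_of_scalingLimit`
(`ArmExponentsFourArm.lean`). [cite: SmirnovWernerMRL2001, Thm. 4 (j = 4) and §4, "the theorem follows from the two observations" (9), (10)] -/
theorem fourArm_exponent_holds_of :
    SmirnovWerner2001_fourArm_scalingLimit → Nolin2008_fourArm_separation → fourArm_exponent :=
  fun hA hsep => fourArm_exponent_of_scalingLimit hA (Werner2009_fourArm_quasiMult_of_separation hsep)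

/-- **Assembly: `ν = 4/3`, i.e. `ξ(p) = |p - 1/2|^{-4/3 + o(1)}` as `p → 1/2` (crit-perc.S16), from
Smirnov–Werner's two observations for `j = 4`** — through the four-arm exponent
(`fourArm_exponent_holds_of`) and Kesten's scaling relation at the characteristic length
(`triCorrLength_exponent_of_separation`, `TriCorrLengthExponentFromSeparation.lean`, whose
near-critical inputs all come from the same separation statement). [cite: SmirnovWernerMRL2001, Thm. 1 (iii)–(iv) and the paragraph following Thm. 1 (arXiv:math/0109120, pp. 3–4)] [cite: KestenScalingCMP1987, (4.5) and Cor. 1–2] -/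
theorem triCorrLength_exponent_holds_of :
    SmirnovWerner2001_fourArm_scalingLimit → Nolin2008_fourArm_separation →
      triCorrLength_exponent :=
  fun hA hsep => triCorrLength_exponent_of_separation (fourArm_exponent_holds_of hA hsep) hsep

end Literature.Probability.Percolation
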